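import Summits.CriticalPhenomena.PercolationContinuityZ3.Theorems.Transplant.SkelPhiFaceNumsDiv
import Summits.CriticalPhenomena.PercolationContinuityZ3.Theorems.Transplant.SkelPhiParaRunFrame
import HarnessLib

/-!
# N1 ({±1} node), (F) inner route, part R5b-ix (hp-8 g33): **THE FINE READING OF A RUN BOX IN STRIDE UNITS** — for a box of the `σ = 1`
# x-frame with along range `[ma, Ma]` (α) and level range `[−B−1, B]` (β′/U), the four reading values of `fine_mem_Icc_of_runX_mem_Icc_signed`
# (relative to the origin's cell `(e₀, e₁)`) are, in stride units, `κ₀·ma/n … κ₀·Ma/n` on axis `0` up to the slant term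
# `κ₀·(Vb/n)·U·(B+1)/mod` (`|vα| ≤ Vb`) and `−κ₁·U·(B+1)/mod … κ₁·U·(B+1)/mod` on axis `1`, with explicit integer slack — the bounds every per-region footprint
# inequality (`hPf`, `hYf`, `hglo/hghi`) is discharged from.
builds on p205010 (kernel theorem, internal audit signed; external expert review pending) — nothing in this file uses p205010; no claim about the open node.
Lane `prim-bschramm`, seat `prim-hp-8` (gen 33); helper file (`--supports stmt-CriticalPhenomena-4575 --as helper`).
* `Skelφ.abs_slant_le`, **`read0_lo_bounds`**, **`read0_hi_bounds`**, **`read1_lo_bounds`**, **`read1_hi_bounds`** (uncorrelated boxes: x-runs);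
  **`read0_corr_lo_bounds`**, **`read0_corr_hi_bounds`** (correlated boxes: drifting y′-runs), `read1_gen_bounds`.
[cite: MartineauTassion2017, §4.1] [cite: Timar2007, Lemma 2.2, p. 3]
-/

namespace Summit.CriticalPhenomena.PercolationContinuityZ3.Theorems.Transplant

namespace Skelφ

open TwoAxis.Para (modulus)

/-- The slant terms `vα·U·(−B−1)`, `vα·(U·B + U − 1)` are at most `Vb·U·(B+1)` in absolute value (`|vα| ≤ Vb`, `0 ≤ B`, `1 ≤ U`). [folklore] -/
theorem abs_slant_le {vα Vb U B : ℤ} (hv : |vα| ≤ Vb) (hU : 1 ≤ U) (hB : 0 ≤ B) :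
    |max (vα * (U * (-B - 1))) (vα * (U * B + U - 1))| ≤ Vb * U * (B + 1) ∧ |min (vα * (U * (-B - 1))) (vα * (U * B + U - 1))| ≤ Vb * U * (B + 1) := by
  have hn : 0 ≤ Vb := (abs_nonneg _).trans hv
  have hUB : 0 ≤ U * (B + 1) := mul_nonneg (by linarith) (by linarith)
  have h1 : |vα * (U * (-B - 1))| ≤ Vb * U * (B + 1) := by
    rw [abs_mul, show U * (-B - 1) = -(U * (B + 1)) by ring, abs_neg, abs_of_nonneg hUB]
    calc |vα| * (U * (B + 1)) ≤ Vb * (U * (B + 1)) := mul_le_mul_of_nonneg_right hv hUB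
      _ = _ := by ring
  have h2 : |vα * (U * B + U - 1)| ≤ Vb * U * (B + 1) := by
    rw [abs_mul]
    have hq : |U * B + U - 1| ≤ U * (B + 1) := by
      rw [abs_le]; constructor <;> nlinarith
    calc |vα| * |U * B + U - 1| ≤ Vb * (U * (B + 1)) := mul_le_mul hv hq (abs_nonneg _) hn
      _ = _ := by ring
  have hA := abs_le.1 h1
  have hB' := abs_le.1 h2
  constructor
  · rw [abs_le]; constructor
    · exact le_trans hA.1 (le_max_left _ _)
    · exact max_le hA.2 hB'.2
  · rw [abs_le]; constructor
    · exact le_min hA.1 hB'.1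
    · exact (min_le_left _ _).trans hA.2


variable {A κ₀ κ₁ mod n vα c₀ c₁ D U : ℤ}

/-- **Axis-0 lower reading of a box** `X = (c₀·(A·(mod·ma − max-slant)/n))/D`:
`κ₀·mod·ma − κ₀·Vb·U·(B+1) − κ₀·n − n·mod ≤ n·mod·X ≤ κ₀·mod·ma + κ₀·Vb·U·(B+1)` (`|vα| ≤ Vb`). [cite: MartineauTassion2017, §4.1] -/
theorem read0_lo_bounds (hA : 0 < A) (hκ : 0 ≤ κ₀) (hmod : 0 < mod) (hn : 0 < n) (hc : c₀ = A * κ₀) (hD : D = A ^ 2 * mod)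
    {Vb : ℤ} (hv : |vα| ≤ Vb) (hU : 1 ≤ U) {B : ℤ} (hB : 0 ≤ B) (ma : ℤ) :
    κ₀ * mod * ma - κ₀ * Vb * U * (B + 1) - κ₀ * n - n * mod ≤
        n * mod * ((c₀ * (A * (mod * ma - max (vα * (U * (-B - 1))) (vα * (U * B + U - 1))) / n)) / D) ∧
      n * mod * ((c₀ * (A * (mod * ma - max (vα * (U * (-B - 1))) (vα * (U * B + U - 1))) / n)) / D) ≤
        κ₀ * mod * ma + κ₀ * Vb * U * (B + 1) := by
  obtain ⟨h1, h2⟩ := reading0_bounds hA hκ hmod hn hc hD (mod * ma - max (vα * (U * (-B - 1))) (vα * (U * B + U - 1)))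
  have hs := abs_le.1 (abs_slant_le hv hU hB).1
  have hk1 : κ₀ * (mod * ma - max (vα * (U * (-B - 1))) (vα * (U * B + U - 1))) ≤ κ₀ * mod * ma + κ₀ * Vb * U * (B + 1) := by nlinarith
  have hk2 : κ₀ * mod * ma - κ₀ * Vb * U * (B + 1) ≤ κ₀ * (mod * ma - max (vα * (U * (-B - 1))) (vα * (U * B + U - 1))) := by nlinarith
  constructor <;> linarith

/-- **Axis-0 upper reading of a box** `X = (c₀·(A·(mod·Ma − min-slant)/n))/D`:
`κ₀·mod·Ma − κ₀·Vb·U·(B+1) − κ₀·n − n·mod ≤ n·mod·X ≤ κ₀·mod·Ma + κ₀·Vb·U·(B+1)` (`|vα| ≤ Vb`). [cite: MartineauTassion2017, §4.1] -/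
theorem read0_hi_bounds (hA : 0 < A) (hκ : 0 ≤ κ₀) (hmod : 0 < mod) (hn : 0 < n) (hc : c₀ = A * κ₀) (hD : D = A ^ 2 * mod)
    {Vb : ℤ} (hv : |vα| ≤ Vb) (hU : 1 ≤ U) {B : ℤ} (hB : 0 ≤ B) (Ma : ℤ) :
    κ₀ * mod * Ma - κ₀ * Vb * U * (B + 1) - κ₀ * n - n * mod ≤
        n * mod * ((c₀ * (A * (mod * Ma - min (vα * (U * (-B - 1))) (vα * (U * B + U - 1))) / n)) / D) ∧
      n * mod * ((c₀ * (A * (mod * Ma - min (vα * (U * (-B - 1))) (vα * (U * B + U - 1))) / n)) / D) ≤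
        κ₀ * mod * Ma + κ₀ * Vb * U * (B + 1) := by
  obtain ⟨h1, h2⟩ := reading0_bounds hA hκ hmod hn hc hD (mod * Ma - min (vα * (U * (-B - 1))) (vα * (U * B + U - 1)))
  have hs := abs_le.1 (abs_slant_le hv hU hB).2
  have hk1 : κ₀ * (mod * Ma - min (vα * (U * (-B - 1))) (vα * (U * B + U - 1))) ≤ κ₀ * mod * Ma + κ₀ * Vb * U * (B + 1) := by nlinarith
  have hk2 : κ₀ * mod * Ma - κ₀ * Vb * U * (B + 1) ≤ κ₀ * (mod * Ma - min (vα * (U * (-B - 1))) (vα * (U * B + U - 1))) := by nlinarith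
  constructor <;> linarith

/-- **Axis-1 lower reading of a box** `X₁ = (c₁·(A·(U·(−B−1))))/D`: `−κ₁·U·(B+1) − mod + 1 ≤ mod·X₁ ≤ −κ₁·U·(B+1)`. [folklore] -/
theorem read1_lo_bounds (hA : 0 < A) (hmod : 0 < mod) (hc : c₁ = A * κ₁) (hD : D = A ^ 2 * mod) (B : ℤ) :
    -(κ₁ * U * (B + 1)) - mod + 1 ≤ mod * ((c₁ * (A * (U * (-B - 1)))) / D) ∧ mod * ((c₁ * (A * (U * (-B - 1)))) / D) ≤ -(κ₁ * U * (B + 1)) := by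
  obtain ⟨h1, h2⟩ := reading1_bounds hA hmod hc hD (U * (-B - 1))
  have e : κ₁ * (U * (-B - 1)) = -(κ₁ * U * (B + 1)) := by ring
  rw [e] at h1 h2
  exact ⟨h1, h2⟩

/-- **Axis-1 upper reading of a box** `X₁ = (c₁·(A·(U·B + U − 1)))/D`: `κ₁·(U·B + U − 1) − mod + 1 ≤ mod·X₁ ≤ κ₁·(U·B + U − 1)`. [folklore] -/
theorem read1_hi_bounds (hA : 0 < A) (hmod : 0 < mod) (hc : c₁ = A * κ₁) (hD : D = A ^ 2 * mod) (B : ℤ) :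
    κ₁ * (U * B + U - 1) - mod + 1 ≤ mod * ((c₁ * (A * (U * B + U - 1))) / D) ∧ mod * ((c₁ * (A * (U * B + U - 1))) / D) ≤ κ₁ * (U * B + U - 1) :=
  reading1_bounds hA hmod hc hD (U * B + U - 1)

/-! ## Correlated boxes (drifting runs): the reading from a CORRELATION bound -/

/-- **Axis-0 reading of a correlated box**: if the along end `mα` and every level `L ∈ [ms − 1, Ms + 1]` of the box satisfy
`|mod·mα − vα·U·L| ≤ Bnd` (the α–β′ correlation along a drifting run's core chain), then the lower reading
`X = (c₀·(A·(mod·mα − max(vα·U·(ms−1), vα·(U·Ms + U − 1)))/n))/D` satisfies `|n·mod·X| ≤ κ₀·(Bnd + 2n) + n·mod` (`|vα| ≤ n`).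
[cite: MartineauTassion2017, §4.1, §4.3] -/
theorem read0_corr_lo_bounds (hA : 0 < A) (hκ : 0 ≤ κ₀) (hmod : 0 < mod) (hn : 0 < n) (hc : c₀ = A * κ₀) (hD : D = A ^ 2 * mod)
    (hv : |vα| ≤ n) {mα ms Ms Bnd : ℤ} (hmM : ms ≤ Ms + 1)
    (hcorr : ∀ L : ℤ, ms - 1 ≤ L → L ≤ Ms + 1 → |mod * mα - vα * (U * L)| ≤ Bnd) :
    -(κ₀ * (Bnd + 2 * n)) - n * mod ≤ n * mod * ((c₀ * (A * (mod * mα - max (vα * (U * (ms - 1))) (vα * (U * Ms + U - 1))) / n)) / D) ∧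
      n * mod * ((c₀ * (A * (mod * mα - max (vα * (U * (ms - 1))) (vα * (U * Ms + U - 1))) / n)) / D) ≤ κ₀ * (Bnd + n) := by
  set T := mod * mα - max (vα * (U * (ms - 1))) (vα * (U * Ms + U - 1)) with hT
  obtain ⟨h1, h2⟩ := reading0_bounds hA hκ hmod hn hc hD T
  have hb1 := abs_le.1 (hcorr (ms - 1) le_rfl (by linarith))
  have hb2 := abs_le.1 (hcorr (Ms + 1) (by linarith) le_rfl)
  have hvv := abs_le.1 hv
  have hva : |vα * (U * (Ms + 1)) - vα * (U * Ms + U - 1)| ≤ n := by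
    rw [show vα * (U * (Ms + 1)) - vα * (U * Ms + U - 1) = vα by ring]; exact hv
  have hva' := abs_le.1 hva
  have hTb : |T| ≤ Bnd + n := by
    rw [hT, abs_le]
    rcases le_total (vα * (U * (ms - 1))) (vα * (U * Ms + U - 1)) with hle | hle
    · rw [max_eq_right hle]; constructor <;> linarith
    · rw [max_eq_left hle]; constructor <;> linarith
  have hTb' := abs_le.1 hTb
  constructor <;> nlinarith

/-- **Axis-0 upper reading of a correlated box** (`min` in place of `max`): `|n·mod·X| ≤ κ₀·(Bnd + 2n) + n·mod`. [folklore] -/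
theorem read0_corr_hi_bounds (hA : 0 < A) (hκ : 0 ≤ κ₀) (hmod : 0 < mod) (hn : 0 < n) (hc : c₀ = A * κ₀) (hD : D = A ^ 2 * mod)
    (hv : |vα| ≤ n) {Mα ms Ms Bnd : ℤ} (hmM : ms ≤ Ms + 1)
    (hcorr : ∀ L : ℤ, ms - 1 ≤ L → L ≤ Ms + 1 → |mod * Mα - vα * (U * L)| ≤ Bnd) :
    -(κ₀ * (Bnd + 2 * n)) - n * mod ≤ n * mod * ((c₀ * (A * (mod * Mα - min (vα * (U * (ms - 1))) (vα * (U * Ms + U - 1))) / n)) / D) ∧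
      n * mod * ((c₀ * (A * (mod * Mα - min (vα * (U * (ms - 1))) (vα * (U * Ms + U - 1))) / n)) / D) ≤ κ₀ * (Bnd + n) := by
  set T := mod * Mα - min (vα * (U * (ms - 1))) (vα * (U * Ms + U - 1)) with hT
  obtain ⟨h1, h2⟩ := reading0_bounds hA hκ hmod hn hc hD T
  have hb1 := abs_le.1 (hcorr (ms - 1) le_rfl (by linarith))
  have hb2 := abs_le.1 (hcorr (Ms + 1) (by linarith) le_rfl)
  have hvv := abs_le.1 hv
  have hva : |vα * (U * (Ms + 1)) - vα * (U * Ms + U - 1)| ≤ n := by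
    rw [show vα * (U * (Ms + 1)) - vα * (U * Ms + U - 1) = vα by ring]; exact hv
  have hva' := abs_le.1 hva
  have hTb : |T| ≤ Bnd + n := by
    rw [hT, abs_le]
    rcases le_total (vα * (U * (ms - 1))) (vα * (U * Ms + U - 1)) with hle | hle
    · rw [min_eq_left hle]; constructor <;> linarith
    · rw [min_eq_right hle]; constructor <;> linarith
  have hTb' := abs_le.1 hTb
  constructor <;> nlinarith

/-- **Axis-1 reading of a general level box** `[L₁ − 1, L₂]`: `X₁lo = (c₁·(A·(U·(L₁−1))))/D`, `X₁hi = (c₁·(A·(U·L₂ + U − 1)))/D` satisfy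
`κ₁·U·(L₁−1) − mod + 1 ≤ mod·X₁lo ≤ κ₁·U·(L₁−1)` and `κ₁·(U·L₂ + U − 1) − mod + 1 ≤ mod·X₁hi ≤ κ₁·(U·L₂ + U − 1)`. [folklore] -/
theorem read1_gen_bounds (hA : 0 < A) (hmod : 0 < mod) (hc : c₁ = A * κ₁) (hD : D = A ^ 2 * mod) (L₁ L₂ : ℤ) :
    (κ₁ * (U * (L₁ - 1)) - mod + 1 ≤ mod * ((c₁ * (A * (U * (L₁ - 1)))) / D) ∧ mod * ((c₁ * (A * (U * (L₁ - 1)))) / D) ≤ κ₁ * (U * (L₁ - 1))) ∧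
      (κ₁ * (U * L₂ + U - 1) - mod + 1 ≤ mod * ((c₁ * (A * (U * L₂ + U - 1))) / D) ∧ mod * ((c₁ * (A * (U * L₂ + U - 1))) / D) ≤ κ₁ * (U * L₂ + U - 1)) :=
  ⟨reading1_bounds hA hmod hc hD (U * (L₁ - 1)), reading1_bounds hA hmod hc hD (U * L₂ + U - 1)⟩

end Skelφ

end Summit.CriticalPhenomena.PercolationContinuityZ3.Theorems.Transplant
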